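import Mathlib
import HarnessLib
import Summits.Ventures.LatticeQCDFlow.Exactness.SUNEngineWilsonEnergyError
import Summits.Ventures.LatticeQCDFlow.Exactness.GaussianQuadraticEquipartition
import Summits.Ventures.LatticeQCDFlow.Exactness.WilsonHeatBathErgodic

/-!
# THE MEAN ACCEPTANCE OF THE ENGINE'S `SU(N)` WILSON HMC IS AT LEAST `1 − C·nε²`, EXPLICITLY, NOTHING ASSUMED: from every configuration and in every law of the configuration, for every `N ≥ 1`, torus `L ≥ 2`, `β`, `ε`, `n`

HONEST FRAMING: exact (Metropolis-corrected) sampling algorithms for lattice gauge theory;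
figures of merit are autocorrelation/cost numbers at stated couplings and volumes; no
continuum-physics claim.

Venture `LatticeQCDFlow` (cell pub-lqcd), topic `Exactness`; FANOUT row 14 (`eng-flowhmc`, family B) serving row 21
(`su3-base`, arm `E2 = PBC-HMC`: the engine's `SU(3)` Wilson HMC).  NEW WORK of the cell: `SUNEngineWilsonEnergyError`
(`engine_wilsonHMC_leapfrog_energy_error_le`: the pointwise law, a polynomial of degree two in `Σ_e‖p_e‖`),
`GaussianQuadraticEquipartition` (equipartition `E q(p_e) = D/2` ⇒ `EΣ_e‖p_e‖ ≤ |E|√(D/2)`, `E(Σ_e‖p_e‖)² ≤ |E|²D/2`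
under the engine's Gaussian refresh `sunMomentumLaw μ (sunKinetic N)`, `D = dim SUNCoords N = N² − 1`), row 9's `SUNMultiStepLeapfrogHMC` (`measurable_sunLeapfrogProposalN`),
row 21's `SUNWilsonHMCForce` (`measurable_sunWilsonForce`), `WilsonHeatBathErgodic` (`continuous_smul_wilsonAction`); nothing is
cited as a fact; no number.

* **`engine_wilsonHMC_meanAcceptance_ge`** — with `C = (N+4#pairs)(2|ε|K_F)·(N²·2N)|ε|`, `b = (2n+1)|ε|F_max/2`,
  `c₁ = (2n+1)|E||ε|F_max/2`, `c₂ = |E||ε|F_max/4`, `M₁ = |E|√(D/2)`, `M₂ = |E|²D/2`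
  (`F_max = sunWilsonForceSup N d β`, `K_F = sunWilsonForceLip N d β`): from EVERY configuration `U`,
  `∫ min(1, e^{−ΔH(U,p)}) d(refresh)(p) ≥ 1 − n·C·(M₂ + (b + c₁ + c₂)M₁ + b(c₁ + c₂))` — `C, b, c₁, c₂` each carry a factor
  `|ε|`, so the deficit is `O(nε²)`; every constant explicit and independent of the torus size except through `|E|`;
* **`engine_wilsonHMC_meanAcceptance_ge_integral`** — the same for the `ν ⊗ refresh` average, ANY probability law `ν` of the
  configuration (in particular the Wilson measure, the chain's invariant law: the equilibrium acceptance RATE of row 21's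
  baseline arm is `≥ 1 − O(nε²)` with these constants).

NOT CLAIMED: optimal constants (the moment side is now the equipartition value, polynomial in `N`; the force-side
constants are crude sup-norm bounds); `L = 1`; the OMF2 average (compose `engine_wilsonHMC_omf2_energy_error_le` the same way); floating point; any number.
-/

noncomputable section

namespace Summit.Ventures.LatticeQCDFlow.Exactness

open Set Function MeasureTheory NormedSpace
open Literature.MathematicalPhysics.QuantumFieldTheory
open scoped Matrix Matrix.Norms.Operator ENNReal

set_option backward.isDefEq.respectTransparency false

section MeanAcceptance

variable (N : ℕ) [NeZero N] (μ : Measure (SUNCoords N)) [μ.IsAddHaarMeasure] {d L : ℕ} [NeZero L]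

set_option maxHeartbeats 400000 in -- RN-23 (7)(b): heavy declaration budgeted at source (lake build ≈ 10 % hungrier than the gate)
/-- **THE MEAN ACCEPTANCE OF THE ENGINE'S `SU(N)` WILSON HMC FROM EVERY CONFIGURATION, NOTHING ASSUMED** (`N ≥ 1`,
torus `L ≥ 2`, every `d`, `β`, `ε`, `n`, `U`): with the constants of the docstring,
`∫ min(1, e^{−ΔH(U,p)}) d(sunMomentumLaw μ (sunKinetic N))(p) ≥ 1 − n·C·(M₂ + (b + c₁ + c₂)M₁ + b(c₁ + c₂))`. -/
theorem engine_wilsonHMC_meanAcceptance_ge (hL : 2 ≤ L) (β ε : ℝ)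
    (U : GaugeConfig d L (Matrix.specialUnitaryGroup (Fin N) ℂ)) (n : ℕ) :
    1 - n * ((N + 4 * Fintype.card (UpperPair N)) * (2 * |ε| * sunWilsonForceLip N d β) *
          ((Fintype.card (Fin N) : ℝ) ^ 2 * (2 * N) * |ε|)) *
        ((Fintype.card (Edge d L) : ℝ) ^ 2 * ((Module.finrank ℝ (SUNCoords N) : ℝ) / 2) +
          ((2 * n + 1) * (2 * |ε| * sunWilsonForceSup N d β / 4) +
              (2 * n + 1) * (Fintype.card (Edge d L) * (2 * |ε| * sunWilsonForceSup N d β / 4)) +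
              Fintype.card (Edge d L) * (2 * |ε| * sunWilsonForceSup N d β) / 8) *
            (Fintype.card (Edge d L) * Real.sqrt ((Module.finrank ℝ (SUNCoords N) : ℝ) / 2)) +
          (2 * n + 1) * (2 * |ε| * sunWilsonForceSup N d β / 4) *
            ((2 * n + 1) * (Fintype.card (Edge d L) * (2 * |ε| * sunWilsonForceSup N d β / 4)) +
              Fintype.card (Edge d L) * (2 * |ε| * sunWilsonForceSup N d β) / 8)) ≤
      ∫ p, min 1 (Real.exp (-((β * wilsonAction (suRep N) (sunLeapfrogProposalN (sunCoordι N) (sunCoordι_skew N) ε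
          (-(ε / 2) • sunWilsonForce N β) n (U, p)).1 +
        sunKinetic N (sunLeapfrogProposalN (sunCoordι N) (sunCoordι_skew N) ε (-(ε / 2) • sunWilsonForce N β) n (U, p)).2) -
        (β * wilsonAction (suRep N) U + sunKinetic N p))))
        ∂(sunMomentumLaw (L := Edge d L) μ (sunKinetic N)) := by
  haveI := isProbabilityMeasure_sunMomentumLaw_sunKinetic N μ (L := Edge d L)
  -- abbreviations
  set Fm : ℝ := sunWilsonForceSup N d β with hFm
  set C : ℝ := (N + 4 * Fintype.card (UpperPair N)) * (2 * |ε| * sunWilsonForceLip N d β) *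
    ((Fintype.card (Fin N) : ℝ) ^ 2 * (2 * N) * |ε|) with hC
  set b : ℝ := (2 * n + 1) * (2 * |ε| * Fm / 4) with hb
  set c₁ : ℝ := (2 * n + 1) * (Fintype.card (Edge d L) * (2 * |ε| * Fm / 4)) with hc₁
  set c₂ : ℝ := Fintype.card (Edge d L) * (2 * |ε| * Fm) / 8 with hc₂
  set α : ℝ := b + c₁ + c₂ with hα
  set M₁ : ℝ := Fintype.card (Edge d L) * Real.sqrt ((Module.finrank ℝ (SUNCoords N) : ℝ) / 2) with hM₁
  set M₂ : ℝ := (Fintype.card (Edge d L) : ℝ) ^ 2 * ((Module.finrank ℝ (SUNCoords N) : ℝ) / 2) with hM₂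
  have hFm0 : 0 ≤ Fm := by rw [hFm]; exact sunWilsonForceSup_nonneg N d β
  have hK0 : 0 ≤ sunWilsonForceLip N d β := sunWilsonForceLip_nonneg N d β
  have hC0 : 0 ≤ C := by rw [hC]; positivity
  have hb0 : 0 ≤ b := by rw [hb]; positivity
  have hc₁0 : 0 ≤ c₁ := by rw [hc₁]; positivity
  have hc₂0 : 0 ≤ c₂ := by rw [hc₂]; positivity
  have hα0 : 0 ≤ α := by rw [hα]; positivity
  set Ψ := sunLeapfrogProposalN (L := Edge d L) (sunCoordι N) (sunCoordι_skew N) ε (-(ε / 2) • sunWilsonForce N β) n with hΨ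
  set ΔH : (Edge d L → SUNCoords N) → ℝ := fun p =>
    (β * wilsonAction (suRep N) (Ψ (U, p)).1 + sunKinetic N (Ψ (U, p)).2) - (β * wilsonAction (suRep N) U + sunKinetic N p) with hΔH
  -- `1 − |x| ≤ min(1, e^{−x})`
  have hacc : ∀ x : ℝ, 1 - |x| ≤ min 1 (Real.exp (-x)) := by
    intro x
    rcases le_or_gt x 0 with hx | hx
    · rw [min_eq_left ((Real.one_le_exp_iff).2 (by linarith))]
      linarith [abs_nonneg x]
    · rw [abs_of_pos hx]
      refine le_min (by linarith) ?_
      linarith [Real.add_one_le_exp (-x)]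
  have hsup : ∀ p : Edge d L → SUNCoords N, ‖p‖ ≤ ∑ e, ‖p e‖ := fun p =>
    (pi_norm_le_iff_of_nonneg (Finset.sum_nonneg fun m _ => norm_nonneg (p m))).2 fun e =>
      Finset.single_le_sum (fun m _ => norm_nonneg (p m)) (Finset.mem_univ e)
  -- the pointwise law, as a polynomial in Σ‖p_e‖
  have hpt : ∀ p : Edge d L → SUNCoords N, |ΔH p| ≤ n * C * ((∑ e, ‖p e‖) ^ 2 + α * ∑ e, ‖p e‖ + b * (c₁ + c₂)) := by
    intro p
    have h := engine_wilsonHMC_leapfrog_energy_error_le N hL β ε U p n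
    rw [← hΨ, ← hFm] at h
    have hs := hsup p
    have hs0 : 0 ≤ ∑ e, ‖p e‖ := Finset.sum_nonneg fun e _ => norm_nonneg _
    refine h.trans ?_
    have hpos : 0 ≤ (∑ e, ‖p e‖ + (2 * n + 1) * (Fintype.card (Edge d L) * (2 * |ε| * Fm / 4))) +
        Fintype.card (Edge d L) * (2 * |ε| * Fm) / 8 := by positivity
    calc (n : ℝ) * ((N + 4 * Fintype.card (UpperPair N)) * (2 * |ε| * sunWilsonForceLip N d β) *
          ((Fintype.card (Fin N) : ℝ) ^ 2 * (2 * N) * |ε| * (‖p‖ + (2 * n + 1) * (2 * |ε| * Fm / 4))) *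
          ((∑ e, ‖p e‖ + (2 * n + 1) * (Fintype.card (Edge d L) * (2 * |ε| * Fm / 4))) + Fintype.card (Edge d L) * (2 * |ε| * Fm) / 8))
        ≤ n * ((N + 4 * Fintype.card (UpperPair N)) * (2 * |ε| * sunWilsonForceLip N d β) *
          ((Fintype.card (Fin N) : ℝ) ^ 2 * (2 * N) * |ε| * (∑ e, ‖p e‖ + (2 * n + 1) * (2 * |ε| * Fm / 4))) *
          ((∑ e, ‖p e‖ + (2 * n + 1) * (Fintype.card (Edge d L) * (2 * |ε| * Fm / 4))) + Fintype.card (Edge d L) * (2 * |ε| * Fm) / 8)) := by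
          gcongr
      _ = n * C * ((∑ e, ‖p e‖) ^ 2 + (b + c₁ + c₂) * ∑ e, ‖p e‖ + b * (c₁ + c₂)) := by
          rw [hC, hb, hc₁, hc₂]; ring
  -- measurability of ΔH and integrability of both sides
  have hS : Measurable fun W : GaugeConfig d L (Matrix.specialUnitaryGroup (Fin N) ℂ) => β * wilsonAction (suRep N) W :=
    (continuous_smul_wilsonAction (suRep N) continuous_suRep β).measurable
  have hgm : Measurable (-(ε / 2) • sunWilsonForce N β :
      GaugeConfig d L (Matrix.specialUnitaryGroup (Fin N) ℂ) → Edge d L → SUNCoords N) :=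
    measurable_pi_lambda _ fun e =>
      (((continuous_apply e).comp (continuous_sunWilsonForce N β)).const_smul (-(ε / 2))).measurable
  have hΨm : Measurable (⇑Ψ) := by
    rw [hΨ]; exact measurable_sunLeapfrogProposalN (sunCoordι N) (sunCoordι_skew N) ε n hgm
  have hT : Measurable (sunKinetic (L := Edge d L) N) := measurable_sunKinetic N
  have hΔm : Measurable ΔH := by
    rw [hΔH]
    have hq : Measurable fun p : Edge d L → SUNCoords N => Ψ (U, p) := hΨm.comp measurable_prodMk_left
    exact ((hS.comp (measurable_fst.comp hq)).add (hT.comp (measurable_snd.comp hq))).sub (measurable_const.add hT)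
  have hacc_int : Integrable (fun p => min 1 (Real.exp (-ΔH p))) (sunMomentumLaw (L := Edge d L) μ (sunKinetic N)) := by
    refine (integrable_const (1 : ℝ)).mono' (measurable_const.min (hΔm.neg.exp)).aestronglyMeasurable
      (Filter.Eventually.of_forall fun p => ?_)
    rw [Real.norm_eq_abs, abs_of_nonneg (le_min zero_le_one (Real.exp_pos _).le)]
    exact min_le_left _ _
  have hint1 : Integrable (fun p : Edge d L → SUNCoords N => ∑ e, ‖p e‖) (sunMomentumLaw (L := Edge d L) μ (sunKinetic N)) :=
    integrable_finsetSum _ fun e _ => integrable_norm_apply_sunKineticLaw N μ e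
  have hint2 : Integrable (fun p : Edge d L → SUNCoords N => (∑ e, ‖p e‖) ^ 2) (sunMomentumLaw (L := Edge d L) μ (sunKinetic N)) :=
    integrable_sq_sum_norm_sunKineticLaw N μ
  have hαs : Integrable (fun p : Edge d L → SUNCoords N => α * ∑ e, ‖p e‖) (sunMomentumLaw (L := Edge d L) μ (sunKinetic N)) :=
    hint1.const_mul α
  have h2α : Integrable (fun p : Edge d L → SUNCoords N => (∑ e, ‖p e‖) ^ 2 + α * ∑ e, ‖p e‖)
      (sunMomentumLaw (L := Edge d L) μ (sunKinetic N)) := hint2.add hαs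
  have hq3 : Integrable (fun p : Edge d L → SUNCoords N => (∑ e, ‖p e‖) ^ 2 + α * ∑ e, ‖p e‖ + b * (c₁ + c₂))
      (sunMomentumLaw (L := Edge d L) μ (sunKinetic N)) := h2α.add (integrable_const _)
  have hCq : Integrable (fun p : Edge d L → SUNCoords N => n * C * ((∑ e, ‖p e‖) ^ 2 + α * ∑ e, ‖p e‖ + b * (c₁ + c₂)))
      (sunMomentumLaw (L := Edge d L) μ (sunKinetic N)) := hq3.const_mul _
  have hpoly_int : Integrable (fun p : Edge d L → SUNCoords N => 1 - n * C * ((∑ e, ‖p e‖) ^ 2 + α * ∑ e, ‖p e‖ + b * (c₁ + c₂)))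
      (sunMomentumLaw (L := Edge d L) μ (sunKinetic N)) := (integrable_const _).sub hCq
  -- integrate the pointwise bound
  have hmono : ∫ p, (1 - n * C * ((∑ e, ‖p e‖) ^ 2 + α * ∑ e, ‖p e‖ + b * (c₁ + c₂)))
        ∂(sunMomentumLaw (L := Edge d L) μ (sunKinetic N)) ≤
      ∫ p, min 1 (Real.exp (-ΔH p)) ∂(sunMomentumLaw (L := Edge d L) μ (sunKinetic N)) :=
    integral_mono hpoly_int hacc_int fun p => ((sub_le_sub_left (hpt p) 1).trans (hacc (ΔH p)))
  have hlhs : ∫ p, (1 - n * C * ((∑ e, ‖p e‖) ^ 2 + α * ∑ e, ‖p e‖ + b * (c₁ + c₂)))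
        ∂(sunMomentumLaw (L := Edge d L) μ (sunKinetic N)) =
      1 - n * C * (∫ p, (∑ e, ‖p e‖) ^ 2 ∂(sunMomentumLaw (L := Edge d L) μ (sunKinetic N)) +
        α * ∫ p, ∑ e, ‖p e‖ ∂(sunMomentumLaw (L := Edge d L) μ (sunKinetic N)) + b * (c₁ + c₂)) := by
    rw [integral_sub (integrable_const _) hCq, integral_const, integral_const_mul, integral_add h2α (integrable_const _),
      integral_add hint2 hαs, integral_const_mul, integral_const]
    simp only [probReal_univ, smul_eq_mul, one_mul]
  have hE2 : ∫ p, (∑ e, ‖p e‖) ^ 2 ∂(sunMomentumLaw (L := Edge d L) μ (sunKinetic N)) ≤ M₂ := by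
    rw [hM₂]; exact integral_sq_sum_norm_sunKineticLaw_le_half_finrank N μ
  have hE1 : ∫ p, ∑ e, ‖p e‖ ∂(sunMomentumLaw (L := Edge d L) μ (sunKinetic N)) ≤ M₁ := by
    rw [hM₁]; exact integral_sum_norm_sunKineticLaw_le_sqrt N μ
  have hfin : 1 - n * C * (M₂ + α * M₁ + b * (c₁ + c₂)) ≤
      1 - n * C * (∫ p, (∑ e, ‖p e‖) ^ 2 ∂(sunMomentumLaw (L := Edge d L) μ (sunKinetic N)) +
        α * ∫ p, ∑ e, ‖p e‖ ∂(sunMomentumLaw (L := Edge d L) μ (sunKinetic N)) + b * (c₁ + c₂)) := by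
    have hcoef : 0 ≤ (n : ℝ) * C := by positivity
    have h1 := mul_le_mul_of_nonneg_left hE1 hα0
    have h3 : (n : ℝ) * C * (∫ p, (∑ e, ‖p e‖) ^ 2 ∂(sunMomentumLaw (L := Edge d L) μ (sunKinetic N)) +
        α * ∫ p, ∑ e, ‖p e‖ ∂(sunMomentumLaw (L := Edge d L) μ (sunKinetic N)) + b * (c₁ + c₂)) ≤
        n * C * (M₂ + α * M₁ + b * (c₁ + c₂)) := mul_le_mul_of_nonneg_left (by linarith) hcoef
    linarith
  have hgoal := (hfin.trans (hlhs.symm.le)).trans hmono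
  rw [hα, hb, hc₁, hc₂, hC, hM₁, hM₂, hFm] at hgoal
  simpa only [hΔH, hΨ] using hgoal

set_option maxHeartbeats 400000 in -- RN-23 (7)(b): heavy declaration budgeted at source (lake build ≈ 10 % hungrier than the gate)
/-- **… and in ANY law of the configuration** (e.g. the Wilson measure, the invariant law of the chain): the
`ν ⊗ refresh`-averaged Metropolis acceptance of the engine's `SU(N)` Wilson HMC obeys the same bound. -/
theorem engine_wilsonHMC_meanAcceptance_ge_integral (hL : 2 ≤ L) (β ε : ℝ) (n : ℕ)
    (ν : Measure (GaugeConfig d L (Matrix.specialUnitaryGroup (Fin N) ℂ))) [IsProbabilityMeasure ν] :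
    1 - n * ((N + 4 * Fintype.card (UpperPair N)) * (2 * |ε| * sunWilsonForceLip N d β) *
          ((Fintype.card (Fin N) : ℝ) ^ 2 * (2 * N) * |ε|)) *
        ((Fintype.card (Edge d L) : ℝ) ^ 2 * ((Module.finrank ℝ (SUNCoords N) : ℝ) / 2) +
          ((2 * n + 1) * (2 * |ε| * sunWilsonForceSup N d β / 4) +
              (2 * n + 1) * (Fintype.card (Edge d L) * (2 * |ε| * sunWilsonForceSup N d β / 4)) +
              Fintype.card (Edge d L) * (2 * |ε| * sunWilsonForceSup N d β) / 8) *
            (Fintype.card (Edge d L) * Real.sqrt ((Module.finrank ℝ (SUNCoords N) : ℝ) / 2)) +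
          (2 * n + 1) * (2 * |ε| * sunWilsonForceSup N d β / 4) *
            ((2 * n + 1) * (Fintype.card (Edge d L) * (2 * |ε| * sunWilsonForceSup N d β / 4)) +
              Fintype.card (Edge d L) * (2 * |ε| * sunWilsonForceSup N d β) / 8)) ≤
      ∫ U, ∫ p, min 1 (Real.exp (-((β * wilsonAction (suRep N) (sunLeapfrogProposalN (sunCoordι N) (sunCoordι_skew N) ε
          (-(ε / 2) • sunWilsonForce N β) n (U, p)).1 +
        sunKinetic N (sunLeapfrogProposalN (sunCoordι N) (sunCoordι_skew N) ε (-(ε / 2) • sunWilsonForce N β) n (U, p)).2) -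
        (β * wilsonAction (suRep N) U + sunKinetic N p))))
        ∂(sunMomentumLaw (L := Edge d L) μ (sunKinetic N)) ∂ν := by
  haveI := isProbabilityMeasure_sunMomentumLaw_sunKinetic N μ (L := Edge d L)
  have hpt := fun U : GaugeConfig d L (Matrix.specialUnitaryGroup (Fin N) ℂ) => engine_wilsonHMC_meanAcceptance_ge N μ hL β ε U n
  set Ψ := sunLeapfrogProposalN (L := Edge d L) (sunCoordι N) (sunCoordι_skew N) ε (-(ε / 2) • sunWilsonForce N β) n with hΨ
  have hS : Measurable fun W : GaugeConfig d L (Matrix.specialUnitaryGroup (Fin N) ℂ) => β * wilsonAction (suRep N) W :=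
    (continuous_smul_wilsonAction (suRep N) continuous_suRep β).measurable
  have hgm : Measurable (-(ε / 2) • sunWilsonForce N β :
      GaugeConfig d L (Matrix.specialUnitaryGroup (Fin N) ℂ) → Edge d L → SUNCoords N) :=
    measurable_pi_lambda _ fun e =>
      (((continuous_apply e).comp (continuous_sunWilsonForce N β)).const_smul (-(ε / 2))).measurable
  have hΨm : Measurable (⇑Ψ) := by
    rw [hΨ]; exact measurable_sunLeapfrogProposalN (sunCoordι N) (sunCoordι_skew N) ε n hgm
  have hT : Measurable (sunKinetic (L := Edge d L) N) := measurable_sunKinetic N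
  have hjoint : Measurable fun z : GaugeConfig d L (Matrix.specialUnitaryGroup (Fin N) ℂ) × (Edge d L → SUNCoords N) =>
      min 1 (Real.exp (-((β * wilsonAction (suRep N) (Ψ z).1 + sunKinetic N (Ψ z).2) -
        (β * wilsonAction (suRep N) z.1 + sunKinetic N z.2)))) :=
    measurable_const.min ((((hS.comp (measurable_fst.comp hΨm)).add (hT.comp (measurable_snd.comp hΨm))).sub
      ((hS.comp measurable_fst).add (hT.comp measurable_snd))).neg.exp)
  have hF : Integrable (fun U : GaugeConfig d L (Matrix.specialUnitaryGroup (Fin N) ℂ) => ∫ p, min 1 (Real.exp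
      (-((β * wilsonAction (suRep N) (Ψ (U, p)).1 + sunKinetic N (Ψ (U, p)).2) - (β * wilsonAction (suRep N) U + sunKinetic N p))))
        ∂(sunMomentumLaw (L := Edge d L) μ (sunKinetic N))) ν := by
    refine (integrable_const (1 : ℝ)).mono' (hjoint.stronglyMeasurable.integral_prod_right'
      (ν := sunMomentumLaw (L := Edge d L) μ (sunKinetic N))).aestronglyMeasurable (Filter.Eventually.of_forall fun U => ?_)
    refine (norm_integral_le_of_norm_le_const (C := 1) (Filter.Eventually.of_forall fun p => ?_)).trans ?_
    · rw [Real.norm_eq_abs, abs_of_nonneg (le_min zero_le_one (Real.exp_pos _).le)]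
      exact min_le_left _ _
    · rw [probReal_univ, mul_one]
  calc _ = ∫ _U : GaugeConfig d L (Matrix.specialUnitaryGroup (Fin N) ℂ), (1 - n * ((N + 4 * Fintype.card (UpperPair N)) *
          (2 * |ε| * sunWilsonForceLip N d β) * ((Fintype.card (Fin N) : ℝ) ^ 2 * (2 * N) * |ε|)) *
        ((Fintype.card (Edge d L) : ℝ) ^ 2 * ((Module.finrank ℝ (SUNCoords N) : ℝ) / 2) +
          ((2 * n + 1) * (2 * |ε| * sunWilsonForceSup N d β / 4) +
              (2 * n + 1) * (Fintype.card (Edge d L) * (2 * |ε| * sunWilsonForceSup N d β / 4)) +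
              Fintype.card (Edge d L) * (2 * |ε| * sunWilsonForceSup N d β) / 8) *
            (Fintype.card (Edge d L) * Real.sqrt ((Module.finrank ℝ (SUNCoords N) : ℝ) / 2)) +
          (2 * n + 1) * (2 * |ε| * sunWilsonForceSup N d β / 4) *
            ((2 * n + 1) * (Fintype.card (Edge d L) * (2 * |ε| * sunWilsonForceSup N d β / 4)) +
              Fintype.card (Edge d L) * (2 * |ε| * sunWilsonForceSup N d β) / 8))) ∂ν := by
          rw [integral_const, probReal_univ, one_smul]
    _ ≤ _ := integral_mono (integrable_const _) hF hpt

set_option maxHeartbeats 400000 in -- RN-23 (7)(b): heavy declaration budgeted at source (lake build ≈ 10 % hungrier than the gate)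
/-- **QUADRATIC FORM OF THE BOUND**: for `|ε| ≤ 1` the deficit is at most `n·ε²·K` with the `ε`-free constant
`K = (N+4#pairs)·2K_F·(N²·2N)·(M₂ + (b₁+c₁₁+c₂₁)M₁ + b₁(c₁₁+c₂₁))`, `b₁ = (2n+1)F_max/2`, `c₁₁ = (2n+1)|E|F_max/2`,
`c₂₁ = |E|F_max/4` (the `|ε| = 1` values): mean acceptance `≥ 1 − n·ε²·K` from every configuration. -/
theorem engine_wilsonHMC_meanAcceptance_ge_quadratic (hL : 2 ≤ L) (β : ℝ) {ε : ℝ} (hε : |ε| ≤ 1)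
    (U : GaugeConfig d L (Matrix.specialUnitaryGroup (Fin N) ℂ)) (n : ℕ) :
    1 - n * ε ^ 2 * ((N + 4 * Fintype.card (UpperPair N)) * (2 * sunWilsonForceLip N d β) *
          ((Fintype.card (Fin N) : ℝ) ^ 2 * (2 * N)) *
        ((Fintype.card (Edge d L) : ℝ) ^ 2 * ((Module.finrank ℝ (SUNCoords N) : ℝ) / 2) +
          ((2 * n + 1) * (2 * sunWilsonForceSup N d β / 4) +
              (2 * n + 1) * (Fintype.card (Edge d L) * (2 * sunWilsonForceSup N d β / 4)) +
              Fintype.card (Edge d L) * (2 * sunWilsonForceSup N d β) / 8) *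
            (Fintype.card (Edge d L) * Real.sqrt ((Module.finrank ℝ (SUNCoords N) : ℝ) / 2)) +
          (2 * n + 1) * (2 * sunWilsonForceSup N d β / 4) *
            ((2 * n + 1) * (Fintype.card (Edge d L) * (2 * sunWilsonForceSup N d β / 4)) +
              Fintype.card (Edge d L) * (2 * sunWilsonForceSup N d β) / 8))) ≤
      ∫ p, min 1 (Real.exp (-((β * wilsonAction (suRep N) (sunLeapfrogProposalN (sunCoordι N) (sunCoordι_skew N) ε
          (-(ε / 2) • sunWilsonForce N β) n (U, p)).1 +
        sunKinetic N (sunLeapfrogProposalN (sunCoordι N) (sunCoordι_skew N) ε (-(ε / 2) • sunWilsonForce N β) n (U, p)).2) -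
        (β * wilsonAction (suRep N) U + sunKinetic N p))))
        ∂(sunMomentumLaw (L := Edge d L) μ (sunKinetic N)) := by
  refine le_trans ?_ (engine_wilsonHMC_meanAcceptance_ge N μ hL β ε U n)
  -- abbreviations: the ε-free pieces
  set F : ℝ := sunWilsonForceSup N d β with hF
  set KF : ℝ := sunWilsonForceLip N d β with hKF
  set c₀ : ℝ := (N + 4 * Fintype.card (UpperPair N)) with hc₀
  set A : ℝ := (Fintype.card (Fin N) : ℝ) ^ 2 * (2 * N) with hA
  set EE : ℝ := (Fintype.card (Edge d L) : ℝ) with hEE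
  set M₁ : ℝ := EE * Real.sqrt ((Module.finrank ℝ (SUNCoords N) : ℝ) / 2) with hM₁
  set M₂ : ℝ := EE ^ 2 * ((Module.finrank ℝ (SUNCoords N) : ℝ) / 2) with hM₂
  have hF0 : 0 ≤ F := by rw [hF]; exact sunWilsonForceSup_nonneg N d β
  have hKF0 : 0 ≤ KF := by rw [hKF]; exact sunWilsonForceLip_nonneg N d β
  have hc₀0 : 0 ≤ c₀ := by rw [hc₀]; positivity
  have hA0 : 0 ≤ A := by rw [hA]; positivity
  have hEE0 : 0 ≤ EE := by rw [hEE]; positivity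
  have hM₁0 : 0 ≤ M₁ := by rw [hM₁]; positivity
  have hM₂0 : 0 ≤ M₂ := by rw [hM₂]; positivity
  have ha0 : 0 ≤ |ε| := abs_nonneg ε
  have hn0 : (0 : ℝ) ≤ n := Nat.cast_nonneg n
  -- the ε-dependent pieces are |ε| times the |ε| = 1 pieces
  have hsq : |ε| * |ε| = ε ^ 2 := by rw [← sq, sq_abs]
  -- compare the two deficits
  have hkey : n * (c₀ * (2 * |ε| * KF) * (A * |ε|)) *
        (M₂ + ((2 * n + 1) * (2 * |ε| * F / 4) + (2 * n + 1) * (EE * (2 * |ε| * F / 4)) + EE * (2 * |ε| * F) / 8) * M₁ +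
          (2 * n + 1) * (2 * |ε| * F / 4) * ((2 * n + 1) * (EE * (2 * |ε| * F / 4)) + EE * (2 * |ε| * F) / 8)) ≤
      n * ε ^ 2 * (c₀ * (2 * KF) * A) *
        (M₂ + ((2 * n + 1) * (2 * F / 4) + (2 * n + 1) * (EE * (2 * F / 4)) + EE * (2 * F) / 8) * M₁ +
          (2 * n + 1) * (2 * F / 4) * ((2 * n + 1) * (EE * (2 * F / 4)) + EE * (2 * F) / 8)) := by
    have hcoef : n * (c₀ * (2 * |ε| * KF) * (A * |ε|)) = n * ε ^ 2 * (c₀ * (2 * KF) * A) := by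
      rw [← hsq]; ring
    rw [hcoef]
    have hcoef0 : 0 ≤ n * ε ^ 2 * (c₀ * (2 * KF) * A) := by positivity
    refine mul_le_mul_of_nonneg_left ?_ hcoef0
    have h1 : 2 * |ε| * F / 4 ≤ 2 * F / 4 := by nlinarith
    have h2 : EE * (2 * |ε| * F / 4) ≤ EE * (2 * F / 4) := mul_le_mul_of_nonneg_left h1 hEE0
    have h3 : EE * (2 * |ε| * F) / 8 ≤ EE * (2 * F) / 8 := by nlinarith
    have hb0 : 0 ≤ 2 * |ε| * F / 4 := by positivity
    have hc10 : 0 ≤ EE * (2 * |ε| * F / 4) := by positivity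
    have hc20 : 0 ≤ EE * (2 * |ε| * F) / 8 := by positivity
    have hn1 : (0 : ℝ) ≤ 2 * n + 1 := by positivity
    gcongr
  linarith [hkey]

set_option maxHeartbeats 400000 in -- RN-23 (7)(b): heavy declaration budgeted at source (lake build ≈ 10 % hungrier than the gate)
/-- **THE SAME WITH `D = N² − 1` WRITTEN OUT** (`GaussianQuadraticEquipartition.finrank_sunCoords_eq`): in any law of
the configuration the mean acceptance of the engine's `SU(N)` Wilson HMC is
`≥ 1 − n·C·(|E|²(N²−1)/2 + (b + c₁ + c₂)|E|√((N²−1)/2) + b(c₁ + c₂))`. -/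
theorem engine_wilsonHMC_meanAcceptance_ge_integral_sq (hL : 2 ≤ L) (β ε : ℝ) (n : ℕ)
    (ν : Measure (GaugeConfig d L (Matrix.specialUnitaryGroup (Fin N) ℂ))) [IsProbabilityMeasure ν] :
    1 - n * ((N + 4 * Fintype.card (UpperPair N)) * (2 * |ε| * sunWilsonForceLip N d β) *
          ((Fintype.card (Fin N) : ℝ) ^ 2 * (2 * N) * |ε|)) *
        ((Fintype.card (Edge d L) : ℝ) ^ 2 * (((N : ℝ) ^ 2 - 1) / 2) +
          ((2 * n + 1) * (2 * |ε| * sunWilsonForceSup N d β / 4) +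
              (2 * n + 1) * (Fintype.card (Edge d L) * (2 * |ε| * sunWilsonForceSup N d β / 4)) +
              Fintype.card (Edge d L) * (2 * |ε| * sunWilsonForceSup N d β) / 8) *
            (Fintype.card (Edge d L) * Real.sqrt (((N : ℝ) ^ 2 - 1) / 2)) +
          (2 * n + 1) * (2 * |ε| * sunWilsonForceSup N d β / 4) *
            ((2 * n + 1) * (Fintype.card (Edge d L) * (2 * |ε| * sunWilsonForceSup N d β / 4)) +
              Fintype.card (Edge d L) * (2 * |ε| * sunWilsonForceSup N d β) / 8)) ≤
      ∫ U, ∫ p, min 1 (Real.exp (-((β * wilsonAction (suRep N) (sunLeapfrogProposalN (sunCoordι N) (sunCoordι_skew N) ε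
          (-(ε / 2) • sunWilsonForce N β) n (U, p)).1 +
        sunKinetic N (sunLeapfrogProposalN (sunCoordι N) (sunCoordι_skew N) ε (-(ε / 2) • sunWilsonForce N β) n (U, p)).2) -
        (β * wilsonAction (suRep N) U + sunKinetic N p))))
        ∂(sunMomentumLaw (L := Edge d L) μ (sunKinetic N)) ∂ν := by
  have h := engine_wilsonHMC_meanAcceptance_ge_integral N μ hL β ε n ν
  rw [finrank_sunCoords_eq N NeZero.one_le] at h
  exact h

end MeanAcceptance

end Summit.Ventures.LatticeQCDFlow.Exactness
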